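import Mathlib
import HarnessLib
import Literature.MathematicalPhysics.QuantumLattice.SchwingerGrowthLinearProofs
import Literature.MathematicalPhysics.QuantumLattice.SchwartzTensor
import Literature.MathematicalPhysics.QuantumLattice.SchwingerOSAxioms

/-!
# Line `Sketch` (coupling response), step Z1a piece B: localisation by slot-disjoint cutoffs

Sub-goal `disjointLocalisedBound` of crux `stmt-QuantumFields-16154` (`HypercubicLimit`), line `Sketch`.
A continuous linear functional `T` on `𝓢(Eⁿ, ℂ)` which is bounded by `M ∏ᵢ |φᵢ|_s` on tensor products
`φ₁ ⊗ ⋯ ⊗ φₙ` of one-point test functions with PAIRWISE DISJOINT supports becomes, after multiplication by a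
product cutoff `P(x) = ∏ᵢ θᵢ(xᵢ)` whose factors `θᵢ` have pairwise disjoint supports, bounded on ALL tensor
products: `P · (φ₁ ⊗ ⋯ ⊗ φₙ) = (θ₁φ₁) ⊗ ⋯ ⊗ (θₙφₙ)` with `tsupport (θᵢφᵢ) ⊆ tsupport θᵢ`, and the Leibniz
bound `|θ φ|_s ≤ 2ˢ |θ|_s |φ|_s` (`schwartzNorm_smulLeftCLM_le`).  Summers' engine E0'' ⇒ E0'
(`norm_le_of_isTensorOf_bound`, Osterwalder–Schrader II, Appendix) then yields the linear bound
`‖T (P · F)‖ ≤ M (2ˢ K)ⁿ (∏ᵢ |θᵢ|_t) |F|_{n t}` with `t, K` depending on `s` (and the one-point space) only.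
-/

noncomputable section

open scoped SchwartzMap
open MeasureTheory Filter Topology
open Literature.MathematicalPhysics.QuantumLattice

namespace Summit.QuantumFields.YangMills.Cruxes.HypercubicLimit.CouplingResponse

section Leibniz

variable {X : Type*} [NormedAddCommGroup X] [NormedSpace ℝ X]

/-- **Leibniz bound for Schwartz norms of finite order.**  For Schwartz functions `θ, φ` the product
`θ • φ` (realised as `SchwartzMap.smulLeftCLM ℂ θ φ`) satisfies `|θ φ|_s ≤ 2ˢ |θ|_s |φ|_s`:
`‖x‖ᵏ ‖Dˡ(θφ)(x)‖ ≤ ∑ⱼ (l choose j) (‖x‖ᵏ ‖Dʲθ(x)‖) ‖D^{l-j}φ(x)‖ ≤ 2ˡ |θ|_s |φ|_s` for `k, l ≤ s`. [folklore] -/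
theorem schwartzNorm_smulLeftCLM_le (s : ℕ) (θ φ : 𝓢(X, ℂ)) :
    schwartzNorm s (SchwartzMap.smulLeftCLM ℂ (θ : X → ℂ) φ) ≤
      2 ^ s * schwartzNorm s θ * schwartzNorm s φ := by
  have hθ : Function.HasTemperateGrowth (θ : X → ℂ) := θ.hasTemperateGrowth
  have hfun : ((SchwartzMap.smulLeftCLM ℂ (θ : X → ℂ) φ : 𝓢(X, ℂ)) : X → ℂ) = fun y => θ y * φ y := by
    ext y
    rw [SchwartzMap.smulLeftCLM_apply_apply hθ, smul_eq_mul]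
  have h0 : 0 ≤ 2 ^ s * schwartzNorm s θ * schwartzNorm s φ :=
    mul_nonneg (mul_nonneg (pow_nonneg zero_le_two s) (schwartzNorm_nonneg _ _))
      (schwartzNorm_nonneg _ _)
  change ((Finset.Iic (s, s)).sup (schwartzSeminormFamily ℂ X ℂ))
    (SchwartzMap.smulLeftCLM ℂ (θ : X → ℂ) φ) ≤ _
  refine Seminorm.finset_sup_apply_le h0 fun kl hkl => ?_
  have hk : kl.1 ≤ s := (Finset.mem_Iic.1 hkl).1
  have hl : kl.2 ≤ s := (Finset.mem_Iic.1 hkl).2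
  rw [SchwartzMap.schwartzSeminormFamily_apply]
  refine SchwartzMap.seminorm_le_bound ℂ kl.1 kl.2 _ h0 fun x => ?_
  rw [hfun]
  calc ‖x‖ ^ kl.1 * ‖iteratedFDeriv ℝ kl.2 (fun y => θ y * φ y) x‖
      ≤ ‖x‖ ^ kl.1 * ∑ i ∈ Finset.range (kl.2 + 1),
          (kl.2.choose i : ℝ) * ‖iteratedFDeriv ℝ i θ x‖ * ‖iteratedFDeriv ℝ (kl.2 - i) φ x‖ :=
        mul_le_mul_of_nonneg_left
          (norm_iteratedFDeriv_mul_le (N := ((⊤ : ℕ∞) : WithTop ℕ∞)) (θ.smooth ⊤) (φ.smooth ⊤) x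
            (mod_cast le_top)) (by positivity)
    _ = ∑ i ∈ Finset.range (kl.2 + 1),
          (kl.2.choose i : ℝ) * (‖x‖ ^ kl.1 * ‖iteratedFDeriv ℝ i θ x‖) *
            ‖iteratedFDeriv ℝ (kl.2 - i) φ x‖ := by
        rw [Finset.mul_sum]
        exact Finset.sum_congr rfl fun i _ => by ring
    _ ≤ ∑ i ∈ Finset.range (kl.2 + 1), (kl.2.choose i : ℝ) * schwartzNorm s θ * schwartzNorm s φ := by
        refine Finset.sum_le_sum fun i hi => ?_
        have hi' : i ≤ s := (Nat.lt_succ_iff.1 (Finset.mem_range.1 hi)).trans hl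
        have h1 : ‖x‖ ^ kl.1 * ‖iteratedFDeriv ℝ i θ x‖ ≤ schwartzNorm s θ :=
          (SchwartzMap.le_seminorm ℂ kl.1 i θ x).trans (seminorm_le_schwartzNorm hk hi' θ)
        have h2 : ‖iteratedFDeriv ℝ (kl.2 - i) φ x‖ ≤ schwartzNorm s φ :=
          (SchwartzMap.norm_iteratedFDeriv_le_seminorm ℂ φ _ x).trans
            (seminorm_le_schwartzNorm (Nat.zero_le _) ((Nat.sub_le _ _).trans hl) φ)
        exact mul_le_mul (mul_le_mul_of_nonneg_left h1 (by positivity)) h2 (norm_nonneg _)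
          (mul_nonneg (by positivity) (schwartzNorm_nonneg _ _))
    _ = 2 ^ kl.2 * schwartzNorm s θ * schwartzNorm s φ := by
        rw [← Finset.sum_mul, ← Finset.sum_mul]
        congr 2
        exact_mod_cast Nat.sum_range_choose kl.2
    _ ≤ 2 ^ s * schwartzNorm s θ * schwartzNorm s φ := by
        have h2s : (2 : ℝ) ^ kl.2 ≤ 2 ^ s := pow_le_pow_right₀ (by norm_num) hl
        exact mul_le_mul_of_nonneg_right (mul_le_mul_of_nonneg_right h2s (schwartzNorm_nonneg _ _))
          (schwartzNorm_nonneg _ _)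

/-- Finite products of complex-valued functions of temperate growth have temperate growth
(induction on the index set with `Function.HasTemperateGrowth.mul`). [folklore] -/
theorem hasTemperateGrowth_finset_prod {ι : Type*} {f : ι → X → ℂ} (u : Finset ι)
    (hf : ∀ i ∈ u, (f i).HasTemperateGrowth) :
    (fun x => ∏ i ∈ u, f i x).HasTemperateGrowth := by
  classical
  induction u using Finset.induction_on with
  | empty => simp
  | insert a u ha ih =>
    have h1 : (f a).HasTemperateGrowth := hf a (Finset.mem_insert_self a u)
    have h2 : (fun x => ∏ i ∈ u, f i x).HasTemperateGrowth :=
      ih fun i hi => hf i (Finset.mem_insert_of_mem hi)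
    have h3 : (f a * fun x => ∏ i ∈ u, f i x).HasTemperateGrowth := h1.mul h2
    simpa only [Finset.prod_insert ha, Pi.mul_def] using h3

end Leibniz

section Localise

variable (E : Type*) [NormedAddCommGroup E] [NormedSpace ℝ E] [FiniteDimensional ℝ E]

/-- **Localisation by slot-disjoint cutoffs** (generic finite-dimensional one-point space `E`).  For every
order `s` there are `t` and `K ≥ 0` such that: if `‖T(φ₁ ⊗ ⋯ ⊗ φₙ)‖ ≤ M ∏ᵢ |φᵢ|_s` for all one-point test
functions with pairwise disjoint supports, then for all cutoffs `θᵢ` with pairwise disjoint supports and all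
`F`, `‖T(P · F)‖ ≤ M Kⁿ (∏ᵢ |θᵢ|_t) |F|_{n t}`, `P(x) = ∏ᵢ θᵢ(xᵢ)`.  Proof: `P · (φ₁ ⊗ ⋯ ⊗ φₙ) =
(θ₁φ₁) ⊗ ⋯ ⊗ (θₙφₙ)` has slot-disjoint factors, so `T ∘ (P ·)` is bounded on all tensor products with constant
`M 2^{sn} ∏ |θᵢ|_s` (`schwartzNorm_smulLeftCLM_le`), and Summers' engine `norm_le_of_isTensorOf_bound`
(OS II, Appendix, E0'' ⇒ E0') gives the linear bound. [folklore] -/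
theorem disjointLocalisedBound_of (s : ℕ) :
    ∃ (t : ℕ) (K : ℝ), 0 ≤ K ∧ ∀ (n : ℕ) (T : 𝓢((Fin n → E), ℂ) →L[ℂ] ℂ) (M : ℝ), 0 ≤ M →
      (∀ (φ : Fin n → 𝓢(E, ℂ)),
        (∀ i j, i ≠ j → Disjoint (tsupport (φ i : E → ℂ)) (tsupport (φ j : E → ℂ))) →
        ∀ F : 𝓢((Fin n → E), ℂ), IsTensorOf F φ → ‖T F‖ ≤ M * ∏ i, schwartzNorm s (φ i)) →
      ∀ (θ : Fin n → 𝓢(E, ℂ)),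
        (∀ i j, i ≠ j → Disjoint (tsupport (θ i : E → ℂ)) (tsupport (θ j : E → ℂ))) →
        ∀ (G F : 𝓢((Fin n → E), ℂ)), (∀ x, G x = (∏ i, θ i (x i)) * F x) →
          ‖T G‖ ≤ M * K ^ n * (∏ i, schwartzNorm t (θ i)) * schwartzNorm (n * t) F := by
  obtain ⟨t₀, K₀, hK₀, hP⟩ := norm_le_of_isTensorOf_bound (E := E) s
  refine ⟨max s t₀, 2 ^ s * K₀, by positivity, ?_⟩
  intro n T M hM hT θ hθ G F hG
  -- the multiplier `P x = ∏ i, θ i (x i)` has temperate growth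
  have hproj : ∀ i : Fin n, (fun x : Fin n → E => θ i (x i)).HasTemperateGrowth := fun i =>
    (θ i).hasTemperateGrowth.comp
      (ContinuousLinearMap.proj (R := ℝ) (φ := fun _ : Fin n => E) i).hasTemperateGrowth
  have hPg : (fun x : Fin n → E => ∏ i, θ i (x i)).HasTemperateGrowth :=
    hasTemperateGrowth_finset_prod Finset.univ fun i _ => hproj i
  -- the localised functional `T ∘ L`, `L F = P · F`
  obtain ⟨L, hL⟩ : ∃ L : 𝓢((Fin n → E), ℂ) →L[ℂ] 𝓢((Fin n → E), ℂ),
      ∀ (F' : 𝓢((Fin n → E), ℂ)) (x : Fin n → E), L F' x = (∏ i, θ i (x i)) * F' x :=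
    ⟨SchwartzMap.smulLeftCLM ℂ (fun x : Fin n → E => ∏ i, θ i (x i)), fun F' x => by
      rw [SchwartzMap.smulLeftCLM_apply_apply hPg, smul_eq_mul]⟩
  have hθ0 : 0 ≤ ∏ i, schwartzNorm s (θ i) := Finset.prod_nonneg fun i _ => schwartzNorm_nonneg _ _
  have hA : 0 ≤ M * (2 ^ s) ^ n * ∏ i, schwartzNorm s (θ i) := by positivity
  -- `T ∘ L` is bounded on ALL tensor products
  have hyp : ∀ (φ : Fin n → 𝓢(E, ℂ)) (F' : 𝓢((Fin n → E), ℂ)), IsTensorOf F' φ →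
      ‖(T.comp L) F'‖ ≤ (M * (2 ^ s) ^ n * ∏ i, schwartzNorm s (θ i)) * ∏ i, schwartzNorm s (φ i) := by
    intro φ F' hF'
    -- the one-point factors `θ i • φ i`
    obtain ⟨ψ, hψ⟩ : ∃ ψ : Fin n → 𝓢(E, ℂ), ∀ i, ψ i = SchwartzMap.smulLeftCLM ℂ (θ i : E → ℂ) (φ i) :=
      ⟨_, fun i => rfl⟩
    have hψapply : ∀ i y, ψ i y = θ i y * φ i y := fun i y => by
      rw [hψ i, SchwartzMap.smulLeftCLM_apply_apply (θ i).hasTemperateGrowth, smul_eq_mul]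
    have hsub : ∀ i, tsupport (ψ i : E → ℂ) ⊆ tsupport (θ i : E → ℂ) := fun i => by
      rw [hψ i]
      exact (SchwartzMap.tsupport_smulLeftCLM_subset _ _).trans Set.inter_subset_right
    have hdisj : ∀ i j, i ≠ j → Disjoint (tsupport (ψ i : E → ℂ)) (tsupport (ψ j : E → ℂ)) :=
      fun i j hij => (hθ i j hij).mono (hsub i) (hsub j)
    have htensor : IsTensorOf (L F') ψ := by
      intro x
      rw [hL, hF', ← Finset.prod_mul_distrib]
      exact Finset.prod_congr rfl fun i _ => (hψapply i (x i)).symm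
    calc ‖(T.comp L) F'‖ = ‖T (L F')‖ := rfl
      _ ≤ M * ∏ i, schwartzNorm s (ψ i) := hT ψ hdisj (L F') htensor
      _ ≤ M * ∏ i, (2 ^ s * schwartzNorm s (θ i) * schwartzNorm s (φ i)) := by
          refine mul_le_mul_of_nonneg_left ?_ hM
          refine Finset.prod_le_prod (fun i _ => schwartzNorm_nonneg _ _) fun i _ => ?_
          rw [hψ i]
          exact schwartzNorm_smulLeftCLM_le s (θ i) (φ i)
      _ = (M * (2 ^ s) ^ n * ∏ i, schwartzNorm s (θ i)) * ∏ i, schwartzNorm s (φ i) := by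
          rw [Finset.prod_mul_distrib, Finset.prod_mul_distrib, Finset.prod_const, Finset.card_univ,
            Fintype.card_fin]
          ring
  -- Summers' engine, applied to `T ∘ L`
  have hmain := hP n (T.comp L) _ hA hyp F
  have hGL : G = L F := by
    ext x
    rw [hG x, hL]
  have hθmono : ∏ i, schwartzNorm s (θ i) ≤ ∏ i, schwartzNorm (max s t₀) (θ i) :=
    Finset.prod_le_prod (fun i _ => schwartzNorm_nonneg _ _) fun i _ =>
      schwartzNorm_mono (le_max_left _ _) _
  have hFmono : schwartzNorm (n * t₀) F ≤ schwartzNorm (n * max s t₀) F :=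
    schwartzNorm_mono (Nat.mul_le_mul_left n (le_max_right _ _)) _
  have hθ0' : 0 ≤ ∏ i, schwartzNorm (max s t₀) (θ i) :=
    Finset.prod_nonneg fun i _ => schwartzNorm_nonneg _ _
  have h2n : (0 : ℝ) ≤ M * (2 ^ s) ^ n := by positivity
  calc ‖T G‖ = ‖(T.comp L) F‖ := by rw [hGL]; rfl
    _ ≤ (M * (2 ^ s) ^ n * ∏ i, schwartzNorm s (θ i)) * K₀ ^ n * schwartzNorm (n * t₀) F := hmain
    _ ≤ (M * (2 ^ s) ^ n * ∏ i, schwartzNorm (max s t₀) (θ i)) * K₀ ^ n *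
          schwartzNorm (n * max s t₀) F :=
        mul_le_mul (mul_le_mul_of_nonneg_right (mul_le_mul_of_nonneg_left hθmono h2n) (pow_nonneg hK₀ n))
          hFmono (schwartzNorm_nonneg _ _)
          (mul_nonneg (mul_nonneg h2n hθ0') (pow_nonneg hK₀ n))
    _ = M * (2 ^ s * K₀) ^ n * (∏ i, schwartzNorm (max s t₀) (θ i)) * schwartzNorm (n * max s t₀) F := by
        rw [mul_pow]
        ring

end Localise

/-- **Registered sub-goal `disjointLocalisedBound` (line `Sketch`, step Z1a piece B).**  Slot-disjoint cutoffs
turn a functional on `𝓢((ℝ⁴)ⁿ, ℂ)` that is product-bounded on tensor products with pairwise disjoint supports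
into one bounded on ALL tensor products, and Summers' E0'' ⇒ E0' engine (`norm_le_of_isTensorOf_bound`) gives
the linear bound `‖T (P · F)‖ ≤ M Kⁿ (∏ᵢ |θᵢ|_t) |F|_{n t}`, `P(x) = ∏ᵢ θᵢ(xᵢ)`; specialisation of
`disjointLocalisedBound_of` to `E = ℝ⁴`. [folklore] -/
theorem disjointLocalisedBound : ∀ s : ℕ, ∃ (t : ℕ) (K : ℝ), 0 ≤ K ∧ ∀ (n : ℕ) (T : 𝓢((Fin n → EuclideanSpace ℝ (Fin 4)), ℂ) →L[ℂ] ℂ) (M : ℝ), 0 ≤ M → (∀ (φ : Fin n → 𝓢(EuclideanSpace ℝ (Fin 4), ℂ)), (∀ i j, i ≠ j → Disjoint (tsupport (φ i : EuclideanSpace ℝ (Fin 4) → ℂ)) (tsupport (φ j : EuclideanSpace ℝ (Fin 4) → ℂ))) → ∀ F : 𝓢((Fin n → EuclideanSpace ℝ (Fin 4)), ℂ), IsTensorOf F φ → ‖T F‖ ≤ M * ∏ i, schwartzNorm s (φ i)) → ∀ (θ : Fin n → 𝓢(EuclideanSpace ℝ (Fin 4), ℂ)), (∀ i j, i ≠ j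 → Disjoint (tsupport (θ i : EuclideanSpace ℝ (Fin 4) → ℂ)) (tsupport (θ j : EuclideanSpace ℝ (Fin 4) → ℂ))) → ∀ (G F : 𝓢((Fin n → EuclideanSpace ℝ (Fin 4)), ℂ)), (∀ x, G x = (∏ i, θ i (x i)) * F x) → ‖T G‖ ≤ M * K ^ n * (∏ i, schwartzNorm t (θ i)) * schwartzNorm (n * t) F :=
  fun s => disjointLocalisedBound_of (EuclideanSpace ℝ (Fin 4)) s

end Summit.QuantumFields.YangMills.Cruxes.HypercubicLimit.CouplingResponse

end
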